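import Literature.NumberTheory.LFunctions.WeilCombNodeWeightsNode

/-!
# Crux `SignCone.ConeMagnification` (stmt-RiemannHypothesis-16303), line `Sketch` r9, stub `stub_combType` — sharp node evaluation VI:
# the parameters of a main-range node

Backstop, part 6.  For a node `n` of the pair `(ℓ, ℓ')` in the MAIN RANGE `8hL²n ≤ 1` (with `0 < h ≤ 1/(32L)`, `hM ≥ 1`, `κ = hM ≥ 2L`)
the cut-offs `K₀' = ⌊1/(4hnℓ')⌋` (deep zone), `K₁ = min M ⌊ℓMe^{−2h}/(ℓ'n)⌋` (full teeth) and `V = K₁nℓ'h/g` (`g = gcd(nℓ',ℓ)`,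
`P = ℓ/g`) satisfy the inequalities used by the sharp node evaluation (`…CombTypeNodeMain`):

* `CombType.node_main_deep` — `P ≤ K₀'`, `1/(8hnℓ') ≤ K₀'`, `1/(4nℓ') − h ≤ hK₀' ≤ 1/(4nℓ')`, `4nℓ'h ≤ 1/2`;
* `CombType.node_main_teeth` — `P ≤ K₁ ≤ M`, `K₁ ≤ ℓM/(ℓ'n)`, `nℓ'K₁e^{2h} ≤ ℓM`, `M ≤ 4L·n·K₁`, `κ/(4L) ≤ V ≤ κL`.
-/

noncomputable section

-- `Summit.RiemannHypothesis.RiemannHypothesis.…` repeats a namespace component by design (D-0017 layout).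
set_option linter.dupNamespace false

open scoped BigOperators
open MeasureTheory Set

namespace Summit.RiemannHypothesis.RiemannHypothesis.Theorems.SignConeConeMagnification

open Literature.NumberTheory.LFunctions

namespace CombType

/-- `P = ℓ/gcd(nℓ',ℓ) ≤ L` and `1 ≤ P` (as reals). [folklore] -/
theorem quot_gcd_bounds {n ℓ ℓ' L : ℕ} (hn : 1 ≤ n) (hℓ : 1 ≤ ℓ) (hℓL : ℓ ≤ L) (hℓ' : 1 ≤ ℓ') :
    (1 : ℝ) ≤ ((ℓ / Nat.gcd (n * ℓ') ℓ : ℕ) : ℝ) ∧ ((ℓ / Nat.gcd (n * ℓ') ℓ : ℕ) : ℝ) ≤ L ∧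
      (1 : ℝ) ≤ (Nat.gcd (n * ℓ') ℓ : ℝ) ∧ (Nat.gcd (n * ℓ') ℓ : ℝ) ≤ ℓ ∧ (Nat.gcd (n * ℓ') ℓ : ℝ) ≤ (n : ℝ) * ℓ' ∧
      ((ℓ / Nat.gcd (n * ℓ') ℓ : ℕ) : ℝ) * (Nat.gcd (n * ℓ') ℓ : ℝ) = ℓ := by
  have hg0 : 0 < Nat.gcd (n * ℓ') ℓ := Nat.gcd_pos_of_pos_right _ (by omega)
  have hgℓ : Nat.gcd (n * ℓ') ℓ ∣ ℓ := Nat.gcd_dvd_right _ _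
  have hga : Nat.gcd (n * ℓ') ℓ ∣ n * ℓ' := Nat.gcd_dvd_left _ _
  have hP1 : 1 ≤ ℓ / Nat.gcd (n * ℓ') ℓ := Nat.div_pos (Nat.le_of_dvd (by omega) hgℓ) hg0
  have hPℓ : ℓ / Nat.gcd (n * ℓ') ℓ ≤ ℓ := Nat.div_le_self _ _
  have hgle : Nat.gcd (n * ℓ') ℓ ≤ ℓ := Nat.le_of_dvd (by omega) hgℓ
  have hga' : Nat.gcd (n * ℓ') ℓ ≤ n * ℓ' := Nat.le_of_dvd (Nat.mul_pos (by omega) (by omega)) hga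
  refine ⟨by exact_mod_cast hP1, by exact_mod_cast hPℓ.trans hℓL, by exact_mod_cast hg0, by exact_mod_cast hgle,
    by exact_mod_cast hga', ?_⟩
  exact_mod_cast Nat.div_mul_cancel hgℓ

/-- **The deep cut-off of a main-range node.** [folklore] -/
theorem node_main_deep {h : ℝ} {n ℓ ℓ' L : ℕ} (hL : 1 ≤ L) (hn : 1 ≤ n) (hℓ : 1 ≤ ℓ) (hℓL : ℓ ≤ L)
    (hℓ' : 1 ≤ ℓ') (hℓ'L : ℓ' ≤ L) (hh : 0 < h) (hnY : 8 * h * L ^ 2 * n ≤ 1) :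
    ((ℓ / Nat.gcd (n * ℓ') ℓ : ℕ) : ℝ) ≤ ⌊1 / (4 * h) / ((n : ℝ) * ℓ')⌋₊ ∧
      1 / (8 * h * n * ℓ') ≤ ⌊1 / (4 * h) / ((n : ℝ) * ℓ')⌋₊ ∧
      h * ⌊1 / (4 * h) / ((n : ℝ) * ℓ')⌋₊ ≤ 1 / (4 * n * ℓ') ∧
      1 / (4 * n * ℓ') - h ≤ h * ⌊1 / (4 * h) / ((n : ℝ) * ℓ')⌋₊ ∧
      4 * n * ℓ' * h ≤ 1 / 2 := by
  obtain ⟨hP1, hPL, -, -, -, -⟩ := quot_gcd_bounds (L := L) hn hℓ hℓL hℓ'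
  have hLR : (1 : ℝ) ≤ L := by exact_mod_cast hL
  have hnR : (1 : ℝ) ≤ n := by exact_mod_cast hn
  have hℓ'R : (1 : ℝ) ≤ ℓ' := by exact_mod_cast hℓ'
  have hℓ'LR : (ℓ' : ℝ) ≤ L := by exact_mod_cast hℓ'L
  have hn0 : (0 : ℝ) < n := by linarith
  have hℓ'0 : (0 : ℝ) < ℓ' := by linarith
  set y : ℝ := 1 / (4 * h) / ((n : ℝ) * ℓ') with hy
  have hy' : y = 1 / (4 * h * n * ℓ') := by rw [hy]; field_simp
  have hy0 : 0 < y := by positivity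
  -- `4 h n ℓ' ≤ 4 h n L ≤ 1/(2L)` and `y ≥ 2L`
  have h4 : 4 * h * n * ℓ' ≤ 1 / (2 * L) := by
    rw [le_div_iff₀ (by positivity)]
    have : 4 * h * n * ℓ' * (2 * L) ≤ 8 * h * L ^ 2 * n := by
      have : (ℓ' : ℝ) * L ≤ L ^ 2 := by nlinarith
      have h' : 0 ≤ 8 * h * n := by positivity
      nlinarith
    linarith
  have hy2L : 2 * (L : ℝ) ≤ y := by
    rw [hy', le_div_iff₀ (by positivity)]
    have := mul_le_mul_of_nonneg_left h4 (by positivity : (0 : ℝ) ≤ 2 * L)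
    rw [mul_one_div, mul_div_assoc] at this
    have e : (2 : ℝ) * L * (1 / (2 * L)) = 1 := by field_simp
    calc 2 * (L : ℝ) * (4 * h * n * ℓ') ≤ 2 * L * (1 / (2 * L)) := mul_le_mul_of_nonneg_left h4 (by positivity)
      _ = 1 := e
  have hfl : y - 1 ≤ ⌊y⌋₊ := by
    have := Nat.lt_floor_add_one y; linarith
  have hfl' : (⌊y⌋₊ : ℝ) ≤ y := Nat.floor_le hy0.le
  refine ⟨?_, ?_, ?_, ?_, ?_⟩
  · linarith
  · have : 1 / (8 * h * n * ℓ') = y / 2 := by rw [hy']; field_simp; ring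
    rw [this]; linarith
  · calc h * ⌊y⌋₊ ≤ h * y := mul_le_mul_of_nonneg_left hfl' hh.le
      _ = 1 / (4 * n * ℓ') := by rw [hy']; field_simp
  · have : h * (y - 1) ≤ h * ⌊y⌋₊ := mul_le_mul_of_nonneg_left hfl hh.le
    have e : h * (y - 1) = 1 / (4 * n * ℓ') - h := by rw [hy']; field_simp
    linarith
  · have : 1 / (2 * (L : ℝ)) ≤ 1 / 2 := one_div_le_one_div_of_le (by norm_num) (by linarith)
    linarith

/-- The real abscissa `x = ℓMe^{−2h}/(ℓ'n)` of the full-teeth cut-off in the main range: `4κL ≤ x ≤ ℓM/(ℓ'n)`. [folklore] -/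
theorem node_main_x {h : ℝ} {n ℓ ℓ' L M : ℕ} (hn : 1 ≤ n) (hℓ : 1 ≤ ℓ) (hℓ' : 1 ≤ ℓ') (hℓ'L : ℓ' ≤ L)
    (hh : 0 < h) (hh4 : h ≤ 1 / 4) (hnY : 8 * h * L ^ 2 * n ≤ 1) :
    4 * (h * M) * L ≤ (ℓ : ℝ) * M * Real.exp (-(2 * h)) / (ℓ' * n) ∧
      (ℓ : ℝ) * M * Real.exp (-(2 * h)) / (ℓ' * n) ≤ (ℓ : ℝ) * M / (ℓ' * n) := by
  have hnR : (1 : ℝ) ≤ n := by exact_mod_cast hn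
  have hℓR : (1 : ℝ) ≤ ℓ := by exact_mod_cast hℓ
  have hℓ'R : (1 : ℝ) ≤ ℓ' := by exact_mod_cast hℓ'
  have hℓ'LR : (ℓ' : ℝ) ≤ L := by exact_mod_cast hℓ'L
  have hn0 : (0 : ℝ) < n := by linarith
  have hℓ'0 : (0 : ℝ) < ℓ' := by linarith
  have hM0 : (0 : ℝ) ≤ M := Nat.cast_nonneg M
  have he1 : Real.exp (-(2 * h)) ≤ 1 := Real.exp_le_one_iff.2 (by linarith)
  have he2 : 1 / 2 ≤ Real.exp (-(2 * h)) := by linarith [Real.add_one_le_exp (-(2 * h))]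
  constructor
  · rw [le_div_iff₀ (by positivity)]
    have h1 : 4 * (h * M) * L * ((ℓ' : ℝ) * n) ≤ 4 * (h * M) * L * (L * n) :=
      mul_le_mul_of_nonneg_left (mul_le_mul_of_nonneg_right hℓ'LR hn0.le) (by positivity)
    have h2 : 4 * (h * (M : ℝ)) * L * (L * n) = 4 * (h * L ^ 2 * n) * M := by ring
    have h3 : 4 * (h * L ^ 2 * n) * (M : ℝ) ≤ (1 / 2) * M :=
      mul_le_mul_of_nonneg_right (by linarith) hM0
    have h4 : (1 / 2) * (M : ℝ) ≤ ℓ * M * Real.exp (-(2 * h)) := by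
      have h5 : (1 : ℝ) * (1 / 2) ≤ ℓ * Real.exp (-(2 * h)) := mul_le_mul hℓR he2 (by norm_num) (by linarith)
      have := mul_le_mul_of_nonneg_right h5 hM0
      calc (1 / 2) * (M : ℝ) = 1 * (1 / 2) * M := by ring
        _ ≤ ℓ * Real.exp (-(2 * h)) * M := this
        _ = ℓ * M * Real.exp (-(2 * h)) := by ring
    linarith
  · apply div_le_div_of_nonneg_right _ (by positivity)
    calc (ℓ : ℝ) * M * Real.exp (-(2 * h)) ≤ ℓ * M * 1 := mul_le_mul_of_nonneg_left he1 (by positivity)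
      _ = ℓ * M := mul_one _

/-- The case `K₁ = M` of `node_main_teeth`. [folklore] -/
theorem node_main_teeth_caseM {h κ g P : ℝ} {n ℓ' L M : ℕ} (hL : 1 ≤ L) (hn : 1 ≤ n)
    (hhL : h ≤ 1 / (32 * L)) (hhM : 1 ≤ h * M) (hκ : κ = h * M)
    (hg0 : 0 < g) (hga : g ≤ (n : ℝ) * ℓ') (hPL : P ≤ L) :
    P ≤ (M : ℝ) ∧ (M : ℝ) ≤ 4 * L * n * (M : ℝ) ∧ κ / (4 * L) ≤ (M : ℝ) * n * ℓ' * h / g := by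
  have hLR : (1 : ℝ) ≤ L := by exact_mod_cast hL
  have hnR : (1 : ℝ) ≤ n := by exact_mod_cast hn
  have hM0 : (0 : ℝ) ≤ M := Nat.cast_nonneg M
  have hMR : (32 : ℝ) * L ≤ M := by
    have h' : h * M * (32 * L) ≤ (1 / (32 * L)) * M * (32 * L) :=
      mul_le_mul_of_nonneg_right (mul_le_mul_of_nonneg_right hhL hM0) (by positivity)
    have e : (1 / (32 * (L : ℝ))) * M * (32 * L) = M := by field_simp
    rw [e] at h'
    calc (32 : ℝ) * L = 1 * (32 * L) := by ring
      _ ≤ h * M * (32 * L) := mul_le_mul_of_nonneg_right hhM (by positivity)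
      _ ≤ M := h'
  refine ⟨by linarith, ?_, ?_⟩
  · have : (1 : ℝ) ≤ 4 * L * n := by nlinarith
    calc (M : ℝ) = 1 * M := (one_mul _).symm
      _ ≤ 4 * L * n * M := mul_le_mul_of_nonneg_right this hM0
  · rw [div_le_div_iff₀ (by positivity) hg0]
    have hκ0 : 0 ≤ κ := by rw [hκ]; positivity
    have h1 : κ * g ≤ κ * ((n : ℝ) * ℓ') := mul_le_mul_of_nonneg_left hga hκ0
    have h2 : κ * ((n : ℝ) * ℓ') * 1 ≤ κ * ((n : ℝ) * ℓ') * (4 * L) :=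
      mul_le_mul_of_nonneg_left (by linarith) (by positivity)
    have e : κ * ((n : ℝ) * ℓ') * (4 * L) = (M : ℝ) * n * ℓ' * h * (4 * L) := by rw [hκ]; ring
    linarith

/-- The case `K₁ = ⌊x⌋` of `node_main_teeth`. [folklore] -/
theorem node_main_teeth_caseFloor {h κ g P x : ℝ} {n ℓ ℓ' L M : ℕ} (hL : 1 ≤ L) (hn : 1 ≤ n) (hℓ : 1 ≤ ℓ)
    (hℓ' : 1 ≤ ℓ') (hℓ'L : ℓ' ≤ L)
    (hh : 0 < h) (hκ : κ = h * M) (hκ2 : 2 ≤ κ)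
    (hg0 : 0 < g) (hgℓ : g ≤ (ℓ : ℝ)) (hPL : P ≤ L)
    (hx : x = (ℓ : ℝ) * M * Real.exp (-(2 * h)) / (ℓ' * n)) (hxge : 4 * κ * L ≤ x) (hh4 : h ≤ 1 / 4) :
    P ≤ (⌊x⌋₊ : ℝ) ∧ (M : ℝ) ≤ 4 * L * n * (⌊x⌋₊ : ℝ) ∧ κ / (4 * L) ≤ (⌊x⌋₊ : ℝ) * n * ℓ' * h / g := by
  have hLR : (1 : ℝ) ≤ L := by exact_mod_cast hL
  have hnR : (1 : ℝ) ≤ n := by exact_mod_cast hn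
  have hℓ'R : (1 : ℝ) ≤ ℓ' := by exact_mod_cast hℓ'
  have hn0 : (0 : ℝ) < n := by linarith
  have hℓ'0 : (0 : ℝ) < ℓ' := by linarith
  have hM0 : (0 : ℝ) ≤ M := Nat.cast_nonneg M
  have he2 : 1 / 2 ≤ Real.exp (-(2 * h)) := by linarith [Real.add_one_le_exp (-(2 * h))]
  have hx8 : 8 ≤ x := by nlinarith
  have hfl : x / 2 ≤ ⌊x⌋₊ := by have := Nat.lt_floor_add_one x; linarith
  have hκ0 : 0 ≤ κ := by linarith
  refine ⟨?_, ?_, ?_⟩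
  · -- `P ≤ L ≤ 2κL ≤ x/2`
    have : (L : ℝ) ≤ 2 * κ * L := by nlinarith
    linarith
  · -- `4 L n (x/2) = 2 L ℓ M e^{-2h}/ℓ' ≥ M`
    have h1 : (M : ℝ) ≤ 4 * L * n * (x / 2) := by
      rw [hx]
      have e : 4 * (L : ℝ) * n * ((ℓ : ℝ) * M * Real.exp (-(2 * h)) / (ℓ' * n) / 2)
          = (2 * L * (ℓ / ℓ') * Real.exp (-(2 * h))) * M := by field_simp; ring
      rw [e]
      have hℓ1 : (1 : ℝ) ≤ ℓ := by exact_mod_cast hℓ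
      have hℓ'LR : (ℓ' : ℝ) ≤ L := by exact_mod_cast hℓ'L
      have hll : 1 / (L : ℝ) ≤ ℓ / ℓ' := by
        rw [div_le_div_iff₀ (by positivity) hℓ'0]
        nlinarith
      have h2 : (1 : ℝ) ≤ 2 * L * (ℓ / ℓ') * Real.exp (-(2 * h)) := by
        calc (1 : ℝ) = 2 * L * (1 / L) * (1 / 2) := by field_simp
          _ ≤ 2 * L * (ℓ / ℓ') * Real.exp (-(2 * h)) :=
              mul_le_mul (mul_le_mul_of_nonneg_left hll (by positivity)) he2 (by norm_num) (by positivity)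
      calc (M : ℝ) = 1 * M := (one_mul _).symm
        _ ≤ (2 * L * (ℓ / ℓ') * Real.exp (-(2 * h))) * M := mul_le_mul_of_nonneg_right h2 hM0
    have h2 : 4 * L * n * (x / 2) ≤ 4 * L * n * (⌊x⌋₊ : ℝ) := mul_le_mul_of_nonneg_left hfl (by positivity)
    linarith
  · -- `V ≥ (x/2) n ℓ' h/g = κ ℓ e^{-2h}/(2? ) ≥ κ/4 ≥ κ/(4L)`
    have h1 : κ / (4 * L) ≤ κ / 4 := div_le_div_of_nonneg_left hκ0 (by norm_num) (by linarith)
    refine h1.trans ?_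
    rw [div_le_div_iff₀ (by norm_num) hg0]
    have h2 : x / 2 * n * ℓ' * h * 4 ≤ (⌊x⌋₊ : ℝ) * n * ℓ' * h * 4 := by
      have : 0 ≤ (n : ℝ) * ℓ' * h * 4 := by positivity
      calc x / 2 * n * ℓ' * h * 4 = x / 2 * (n * ℓ' * h * 4) := by ring
        _ ≤ ⌊x⌋₊ * (n * ℓ' * h * 4) := mul_le_mul_of_nonneg_right hfl this
        _ = (⌊x⌋₊ : ℝ) * n * ℓ' * h * 4 := by ring
    have h3 : κ * g ≤ x / 2 * n * ℓ' * h * 4 := by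
      have e : x / 2 * n * ℓ' * h * 4 = 2 * κ * ℓ * Real.exp (-(2 * h)) := by rw [hx, hκ]; field_simp; ring
      rw [e]
      have : g * 1 ≤ (ℓ : ℝ) * (2 * Real.exp (-(2 * h))) := mul_le_mul hgℓ (by linarith) (by norm_num) (by linarith)
      calc κ * g = κ * (g * 1) := by ring
        _ ≤ κ * (ℓ * (2 * Real.exp (-(2 * h)))) := mul_le_mul_of_nonneg_left this hκ0
        _ = 2 * κ * ℓ * Real.exp (-(2 * h)) := by ring
    linarith

/-- **The full-teeth cut-off of a main-range node.** [folklore] -/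
theorem node_main_teeth {h : ℝ} {n ℓ ℓ' L M : ℕ} (hL : 1 ≤ L) (hn : 1 ≤ n) (hℓ : 1 ≤ ℓ) (hℓL : ℓ ≤ L)
    (hℓ' : 1 ≤ ℓ') (hℓ'L : ℓ' ≤ L) (hh : 0 < h) (hhL : h ≤ 1 / (32 * L)) (hhM : 1 ≤ h * M)
    (hκL : 2 * (L : ℝ) ≤ h * M) (hnY : 8 * h * L ^ 2 * n ≤ 1) :
    ((ℓ / Nat.gcd (n * ℓ') ℓ : ℕ) : ℝ) ≤ ((min M ⌊(ℓ : ℝ) * M * Real.exp (-(2 * h)) / (ℓ' * n)⌋₊ : ℕ) : ℝ) ∧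
      min M ⌊(ℓ : ℝ) * M * Real.exp (-(2 * h)) / (ℓ' * n)⌋₊ ≤ M ∧
      ((min M ⌊(ℓ : ℝ) * M * Real.exp (-(2 * h)) / (ℓ' * n)⌋₊ : ℕ) : ℝ) ≤ (ℓ : ℝ) * M / (ℓ' * n) ∧
      (n : ℝ) * ℓ' * ((min M ⌊(ℓ : ℝ) * M * Real.exp (-(2 * h)) / (ℓ' * n)⌋₊ : ℕ) : ℝ) * Real.exp (2 * h) ≤ ℓ * M ∧
      (M : ℝ) ≤ 4 * L * n * ((min M ⌊(ℓ : ℝ) * M * Real.exp (-(2 * h)) / (ℓ' * n)⌋₊ : ℕ) : ℝ) ∧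
      h * M / (4 * L) ≤ ((min M ⌊(ℓ : ℝ) * M * Real.exp (-(2 * h)) / (ℓ' * n)⌋₊ : ℕ) : ℝ) * n * ℓ' * h / Nat.gcd (n * ℓ') ℓ ∧
      ((min M ⌊(ℓ : ℝ) * M * Real.exp (-(2 * h)) / (ℓ' * n)⌋₊ : ℕ) : ℝ) * n * ℓ' * h / Nat.gcd (n * ℓ') ℓ ≤ h * M * L := by
  obtain ⟨hP1, hPL, hg1, hgℓ, hga, hPg⟩ := quot_gcd_bounds (L := L) hn hℓ hℓL hℓ'
  have hLR : (1 : ℝ) ≤ L := by exact_mod_cast hL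
  have hnR : (1 : ℝ) ≤ n := by exact_mod_cast hn
  have hℓ'R : (1 : ℝ) ≤ ℓ' := by exact_mod_cast hℓ'
  have hn0 : (0 : ℝ) < n := by linarith
  have hℓ'0 : (0 : ℝ) < ℓ' := by linarith
  have h32 : 1 / (32 * (L : ℝ)) ≤ 1 / 32 := one_div_le_one_div_of_le (by norm_num) (by linarith)
  have hh4 : h ≤ 1 / 4 := by linarith
  have hg0 : (0 : ℝ) < (Nat.gcd (n * ℓ') ℓ : ℝ) := by linarith
  have hκ2 : (2 : ℝ) ≤ h * M := le_trans (by linarith) hκL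
  obtain ⟨hxge, hxle⟩ := node_main_x (M := M) hn hℓ hℓ' hℓ'L hh hh4 hnY
  set x : ℝ := (ℓ : ℝ) * M * Real.exp (-(2 * h)) / (ℓ' * n) with hx
  have hx0 : 0 ≤ x := by positivity
  have hK₁x : ((min M ⌊x⌋₊ : ℕ) : ℝ) ≤ x :=
    le_trans (by exact_mod_cast min_le_right _ _) (Nat.floor_le hx0)
  have hlow : ((ℓ / Nat.gcd (n * ℓ') ℓ : ℕ) : ℝ) ≤ ((min M ⌊x⌋₊ : ℕ) : ℝ) ∧
      (M : ℝ) ≤ 4 * L * n * ((min M ⌊x⌋₊ : ℕ) : ℝ) ∧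
      h * M / (4 * L) ≤ ((min M ⌊x⌋₊ : ℕ) : ℝ) * n * ℓ' * h / Nat.gcd (n * ℓ') ℓ := by
    rcases le_total M ⌊x⌋₊ with hcase | hcase
    · rw [min_eq_left hcase]
      exact node_main_teeth_caseM (κ := h * M) hL hn hhL hhM rfl hg0 hga hPL
    · rw [min_eq_right hcase]
      exact node_main_teeth_caseFloor (κ := h * M) hL hn hℓ hℓ' hℓ'L hh rfl hκ2 hg0 hgℓ hPL hx hxge hh4
  obtain ⟨hPK, hM4, hVlow⟩ := hlow
  have hee : Real.exp (-(2 * h)) * Real.exp (2 * h) = 1 := by rw [← Real.exp_add]; simp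
  refine ⟨hPK, min_le_left _ _, hK₁x.trans hxle, ?_, hM4, hVlow, ?_⟩
  · calc (n : ℝ) * ℓ' * ((min M ⌊x⌋₊ : ℕ) : ℝ) * Real.exp (2 * h) ≤ (n : ℝ) * ℓ' * x * Real.exp (2 * h) := by
          refine mul_le_mul_of_nonneg_right (mul_le_mul_of_nonneg_left hK₁x (by positivity)) (Real.exp_pos _).le
      _ = ℓ * M := by rw [hx]; field_simp; rw [mul_assoc, hee, mul_one]
  · have hMh : 0 ≤ (n : ℝ) * ℓ' * h := by positivity
    calc ((min M ⌊x⌋₊ : ℕ) : ℝ) * n * ℓ' * h / Nat.gcd (n * ℓ') ℓ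
        ≤ ((ℓ : ℝ) * M / (ℓ' * n)) * n * ℓ' * h / Nat.gcd (n * ℓ') ℓ := by
          apply div_le_div_of_nonneg_right _ hg0.le
          have := hK₁x.trans hxle
          calc ((min M ⌊x⌋₊ : ℕ) : ℝ) * n * ℓ' * h = ((min M ⌊x⌋₊ : ℕ) : ℝ) * (n * ℓ' * h) := by ring
            _ ≤ ((ℓ : ℝ) * M / (ℓ' * n)) * (n * ℓ' * h) := mul_le_mul_of_nonneg_right this hMh
            _ = _ := by ring
      _ = h * M * (ℓ / Nat.gcd (n * ℓ') ℓ) := by field_simp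
      _ ≤ h * M * L := by
          apply mul_le_mul_of_nonneg_left _ (by positivity)
          rw [div_le_iff₀ hg0]
          have hℓLR : (ℓ : ℝ) ≤ L := by exact_mod_cast hℓL
          nlinarith

/-- **Anchor `combTypeNodeTeeth`** (registered sub-goal; `node_main_teeth` with explicit quantifiers): the full-teeth cut-off of a
main-range node. [folklore] -/
theorem combTypeNodeTeeth : ∀ h : ℝ, ∀ n ℓ ℓ' L M : ℕ, (1 ≤ L) → (1 ≤ n) → (1 ≤ ℓ) → (ℓ ≤ L) → (1 ≤ ℓ') → (ℓ' ≤ L) → (0 < h) → (h ≤ 1 / (32 * L)) → (1 ≤ h * M) → (2 * (L : ℝ) ≤ h * M) → (8 * h * L ^ 2 * n ≤ 1) → ((ℓ / Nat.gcd (n * ℓ') ℓ : ℕ) : ℝ) ≤ ((min M ⌊(ℓ : ℝ) * M * Real.exp (-(2 * h)) / (ℓ' * n)⌋₊ : ℕ) : ℝ) ∧ min M ⌊(ℓ : ℝ) * M * Real.exp (-(2 * h)) / (ℓ' * n)⌋₊ ≤ M ∧ ((min M ⌊(ℓ : ℝ) * M * Real.exp (-(2 * h)) / (ℓ' * n)⌋₊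 : ℕ) : ℝ) ≤ (ℓ : ℝ) * M / (ℓ' * n) ∧ (n : ℝ) * ℓ' * ((min M ⌊(ℓ : ℝ) * M * Real.exp (-(2 * h)) / (ℓ' * n)⌋₊ : ℕ) : ℝ) * Real.exp (2 * h) ≤ ℓ * M ∧ (M : ℝ) ≤ 4 * L * n * ((min M ⌊(ℓ : ℝ) * M * Real.exp (-(2 * h)) / (ℓ' * n)⌋₊ : ℕ) : ℝ) ∧ h * M / (4 * L) ≤ ((min M ⌊(ℓ : ℝ) * M * Real.exp (-(2 * h)) / (ℓ' * n)⌋₊ : ℕ) : ℝ) * n * ℓ' * h / Nat.gcd (n * ℓ') ℓ ∧ ((min M ⌊(ℓ : ℝ) * M * Real.exp (-(2 * h)) / (ℓ' * n)⌋₊ : ℕ) : ℝ) * n * ℓ' * h / Nat.gcd (n * ℓ') ℓ ≤ h * M * L :=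
  fun _ _ _ _ _ _ hL hn hℓ hℓL hℓ' hℓ'L hh hhL hhM hκL hnY => node_main_teeth hL hn hℓ hℓL hℓ' hℓ'L hh hhL hhM hκL hnY

end CombType

end Summit.RiemannHypothesis.RiemannHypothesis.Theorems.SignConeConeMagnification

end
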